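import Summits.BirchSwinnertonDyer.BirchSwinnertonDyer.Theorems.Rank2Observatory2DescClPrimeCert
import Summits.BirchSwinnertonDyer.BirchSwinnertonDyer.Theorems.Rank2Observatory2DescSignature
import Summits.BirchSwinnertonDyer.BirchSwinnertonDyer.Theorems.Rank2Observatory2DescFunctionals
import HarnessLib

/-!
# BirchSwinnertonDyer — rank ≥ 2 observatory: KERNEL-2DESC-CL v2.0 — the per-field certificate `ClFieldCert` and its checker

HONEST FRAMING: per-curve certified theorems and census instruments; no claim on BSD in rank ≥ 2.

Third generic file of the reflective reshape of the class-group-general kernel 2-descent (cell `b2b-bsdr2`,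
seat cert-1; design `b2b-bsdr2-cert-1/KERNEL-2DESC-CL.md` §7; gate4 CERT-LANE RULING: ONE Boolean checker
over a per-field record, ONE soundness layer).  `TwoDescCl.ClFieldCert` is the RECORD of a complex monogenic
cubic field `K = ℚ(α)`, `g(α) = 0`, `g = X³ + aX² + bX + c` (`𝓞 K = ℤ[α]` certified prime by prime), with
even class number and an AUXILIARY PRIME `q = W₁·W₂` (`f(W₁) = 1`, `f(W₂) = 2`) whose degree-one prime `W₁`
generates the class group (Design U of the v1 lane, p312739): the isolating interval of the real root, the
Minkowski range `bM` with the class certificates of the sweep, the registry rows (`PrimeEntry`, file 2) of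
the rational primes met by the census curves on `K` with their attached elements `g_P`
(`(g_P) = P · W₁^e`), and the residue characters `ψ_{ℓ,t}`.  `ClFieldCert.check : Bool` verifies the record
by integer arithmetic (run ONCE per field by `decide +kernel` in the row files); this file proves the
FIELD-LEVEL consequences consumed by the per-curve soundness theorem (file 4):

* `irreducible_of_check` (so `K = CubicField a b c` is a field), `units_rank_of_check` (`r = 1`, `Δ < 0`),
  `exists_rho_of_check` (the real place with `lo < ρ(α) < hi`), `exists_psi_of_check` (the residue maps);
* `w₁_mem_primesOver_of_check`, `w₂_…`, `qcover_of_check` (the primes above `q`);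
* `closure_q_eq_top_of_check` — **the classes of the primes above `q` generate `Cl(K)`**, from the Minkowski
  sweep `eq_top_of_classIn_lt` (p311906) fed by the class certificates of the registry rows;
* `row_check_of_mem`, `prime_of_mem` — every registry row is checked and its `p` is prime (`p ≠ q`).

Sorry-free; axioms `propext`, `Classical.choice`, `Quot.sound`.
[cite: Cohen1993, §4.8.2, §6.5] [cite: Marcus2018, Ch. 5, Thm. 35 and Cor. 2, Thm. 38] [cite: Cassels1991LecturesEllipticCurves, §15]
-/

set_option linter.dupNamespace false

noncomputable section

open scoped Classical NumberField nonZeroDivisors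

open Literature.NumberTheory.NumberFields Polynomial Module NumberField IsDedekindDomain Ideal

namespace Summit.BirchSwinnertonDyer.BirchSwinnertonDyer.Rank2Observatory.TwoDescCl

open TwoDescCubic

/-! ## The record -/

/-- **Per-field certificate** of a complex monogenic cubic field with auxiliary prime `q` (Design U).
Pure data. [cite: Cohen1993, §6.5] -/
structure ClFieldCert where
  /-- `g = X³ + aX² + bX + c` -/
  a : ℤ
  /-- `g = X³ + aX² + bX + c` -/
  b : ℤ
  /-- `g = X³ + aX² + bX + c` -/
  c : ℤ
  /-- a modulus modulo which `g` has no root (irreducibility) -/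
  pIrr : ℕ
  /-- isolating interval `0 ≤ lo < α < hi` of the real root -/
  lo : ℚ
  /-- isolating interval `0 ≤ lo < α < hi` of the real root -/
  hi : ℚ
  /-- Minkowski range: `64·|Δ(g)| < 799·bM²` -/
  bM : ℕ
  /-- the auxiliary prime `q = W₁W₂` -/
  q : ℕ
  /-- `(r, u, v)`: `g ≡ (X − r)(X² + uX + v) (mod q)` -/
  qr : ℤ × ℤ × ℤ
  /-- cofactor coefficients of that congruence -/
  qs : ℤ × ℤ × ℤ
  /-- residue characters `(ℓ, t, dinv)`: `g(t) ≡ 0`, `dinv · |Δ(g)| ≡ 1 (mod ℓ)` -/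
  chars : List (ℕ × ℤ × ℤ)
  /-- the fundamental unit `ε` (`g`, sign bit, `δ = ε⁻¹`); certified per curve by `famCheck` (file 4) -/
  fu : ElemEntry
  /-- the element `γ` with `(γ) = W₁^e` (`g`, sign bit, `δ`, `k` with `γδ = q^k`, `e`, inverse modulo `W₂`);
  certified per curve by `famCheck` (file 4) -/
  gam : ElemEntry
  /-- registry rows of the rational primes (sweep primes and the primes met by the curves), never `q` -/
  primes : List PrimeEntry

namespace ClFieldCert

variable (fc : ClFieldCert)

/-- The registry row of `q` itself (type `1`). -/
def qEntry : PrimeEntry := ⟨fc.q, 1, fc.qr, fc.qs, [], []⟩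

/-- Code of `W₁ = (q, α − r)`. -/
def w₁ : PCode := (fc.q, -fc.qr.1, 1, 0)

/-- Code of `W₂ = (q, α² + uα + v)`. -/
def w₂ : PCode := (fc.q, fc.qr.2.2, fc.qr.2.1, 1)

/-- The primes whose primality the row files discharge by `norm_num`: `q`, the character moduli, the
registry primes. -/
def primeList : List ℕ := fc.q :: (fc.chars.map fun ch => ch.1) ++ fc.primes.map PrimeEntry.p

/-- `n < 32²` has a factor `d` with `2 ≤ d`, `d² ≤ n` — a cheap compositeness flag for the sweep coverage.
Computable. [folklore] -/
def smallFactor (n : ℕ) : Bool := (List.range 32).any fun d => 2 ≤ d && d * d ≤ n && n % d == 0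

/-- Field clause: irreducibility, `Δ < 0`, the isolating interval. Computable. -/
def checkField : Bool :=
  noRootMod fc.pIrr fc.a fc.b fc.c && decide (MonicCubic.disc fc.a fc.b fc.c < 0) &&
    decide (0 ≤ fc.lo ∧ fc.lo < fc.hi ∧ fc.lo ^ 3 + (fc.a : ℚ) * fc.lo ^ 2 + (fc.b : ℚ) * fc.lo + (fc.c : ℚ) < 0 ∧
      0 < fc.hi ^ 3 + (fc.a : ℚ) * fc.hi ^ 2 + (fc.b : ℚ) * fc.hi + (fc.c : ℚ))

/-- Sweep clause: the Minkowski inequality, coverage of every prime `p < bM` by `q` or a registry row, and a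
class certificate for every code of every registry row inside the range. Computable.
[cite: Marcus2018, Ch. 5, Cor. 2 to Thm. 35] -/
def checkSweep : Bool :=
  decide (64 * |MonicCubic.disc fc.a fc.b fc.c| < 799 * (fc.bM : ℤ) ^ 2) &&
    ((List.range fc.bM).all fun n =>
      decide (n < 2) || smallFactor n || n == fc.q || fc.primes.any fun e => e.p == n) &&
    fc.primes.all fun e => decide (fc.bM ≤ e.p) ||
      e.codes.all fun C => e.cls.any fun d => classCheck fc.a fc.b fc.c fc.q fc.bM C d

/-- Registry clause: the row of `q` and every registry row is checked; registry primes are not `q`. -/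
def checkRegistry : Bool :=
  fc.qEntry.check fc.a fc.b fc.c && fc.primes.all fun e => e.check fc.a fc.b fc.c && e.p != fc.q

/-- Character clause: `ℓ > 2`, `g(t) ≡ 0 (mod ℓ)`, `dinv·|Δ| ≡ 1 (mod ℓ)`. Computable.
[cite: Marcus2018, Ch. 3, Thm. 27] -/
def checkChars : Bool :=
  fc.chars.all fun ch => decide (2 < ch.1) &&
    decide ((ch.2.1 ^ 3 + fc.a * ch.2.1 ^ 2 + fc.b * ch.2.1 + fc.c) % (ch.1 : ℤ) = 0) &&
    decide (((MonicCubic.disc fc.a fc.b fc.c).natAbs : ℤ) * ch.2.2 % (ch.1 : ℤ) = 1)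

/-- **The per-field checker.** Computable; run once per field by `decide +kernel`. -/
def check : Bool := fc.checkField && fc.checkSweep && fc.checkRegistry && fc.checkChars

end ClFieldCert

/-! ## Soundness: field-level consequences -/

variable {K : Type*} [Field K] [NumberField K] {θ : K} (fc : ClFieldCert)

namespace ClFieldCert

/-- `g` is irreducible. [folklore] -/
theorem irreducible_of_check (hF : fc.check = true) : Irreducible (MonicCubic.polyQ fc.a fc.b fc.c) := by
  simp only [check, checkField, Bool.and_eq_true] at hF
  exact irreducible_of_noRootMod hF.1.1.1.1.1

/-- `Δ(g) < 0`. [folklore] -/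
theorem disc_neg_of_check (hF : fc.check = true) : MonicCubic.disc fc.a fc.b fc.c < 0 := by
  simp only [check, checkField, Bool.and_eq_true, decide_eq_true_eq] at hF
  exact hF.1.1.1.1.2

/-- The interval facts: `0 ≤ lo < hi`, `g(lo) < 0 < g(hi)`. [folklore] -/
theorem interval_of_check (hF : fc.check = true) :
    0 ≤ fc.lo ∧ fc.lo < fc.hi ∧ fc.lo ^ 3 + (fc.a : ℚ) * fc.lo ^ 2 + (fc.b : ℚ) * fc.lo + (fc.c : ℚ) < 0 ∧
      0 < fc.hi ^ 3 + (fc.a : ℚ) * fc.hi ^ 2 + (fc.b : ℚ) * fc.hi + (fc.c : ℚ) := by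
  simp only [check, checkField, Bool.and_eq_true, decide_eq_true_eq] at hF
  exact hF.1.1.1.2

/-- Unit rank `1`. [cite: Marcus2018, Ch. 5, Thm. 38] -/
theorem units_rank_of_check (hθ : aeval θ (MonicCubic.poly fc.a fc.b fc.c) = 0) (h3 : finrank ℚ K = 3)
    (hF : fc.check = true) : NumberField.Units.rank K = 1 :=
  units_rank_eq_one_of_disc_neg (fc.irreducible_of_check hF) hθ h3 (fc.disc_neg_of_check hF)

/-- The real place with `lo < ρ(α) < hi`. [folklore] -/
theorem exists_rho_of_check (hθ : aeval θ (MonicCubic.poly fc.a fc.b fc.c) = 0) (h3 : finrank ℚ K = 3)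
    (hF : fc.check = true) : ∃ ρ : K →+* ℝ, ((fc.lo : ℚ) : ℝ) < ρ θ ∧ ρ θ < ((fc.hi : ℚ) : ℝ) := by
  obtain ⟨-, hlt, hlo, hhi⟩ := fc.interval_of_check hF
  exact exists_real_embedding_of_sign_change (fc.irreducible_of_check hF) hθ h3 hlt hlo hhi

/-! ### Primality bookkeeping -/

/-- `q` is prime (from the primality list). -/
theorem q_prime (hpr : fc.primeList.Forall Nat.Prime) : fc.q.Prime := by
  rw [List.forall_iff_forall_mem] at hpr
  exact hpr _ (by simp [primeList])

/-- Character moduli are prime. -/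
theorem char_prime (hpr : fc.primeList.Forall Nat.Prime) {ch : ℕ × ℤ × ℤ} (hch : ch ∈ fc.chars) :
    ch.1.Prime := by
  rw [List.forall_iff_forall_mem] at hpr
  refine hpr _ ?_
  simp only [primeList, List.mem_cons, List.mem_append, List.mem_map]
  exact Or.inl (Or.inr ⟨ch, hch, rfl⟩)

/-- Registry primes are prime. -/
theorem prime_of_mem (hpr : fc.primeList.Forall Nat.Prime) {e : PrimeEntry} (he : e ∈ fc.primes) :
    e.p.Prime := by
  rw [List.forall_iff_forall_mem] at hpr
  refine hpr _ ?_
  simp only [primeList, List.mem_cons, List.mem_append, List.mem_map]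
  exact Or.inr ⟨e, he, rfl⟩

/-- Every registry row is checked, and its prime is not `q`. -/
theorem row_check_of_mem (hF : fc.check = true) {e : PrimeEntry} (he : e ∈ fc.primes) :
    e.check fc.a fc.b fc.c = true ∧ e.p ≠ fc.q := by
  simp only [check, checkRegistry, Bool.and_eq_true, List.all_eq_true] at hF
  have h := hF.1.2.2 e he
  exact ⟨h.1, by simpa using h.2⟩

/-- The row of `q` is checked. -/
theorem qEntry_check (hF : fc.check = true) : fc.qEntry.check fc.a fc.b fc.c = true := by
  simp only [check, checkRegistry, Bool.and_eq_true] at hF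
  exact hF.1.2.1

/-! ### The primes above `q` -/

/-- The codes of the row of `q` are `[w₁, w₂]`. -/
theorem qEntry_codes : fc.qEntry.codes = [fc.w₁, fc.w₂] := by
  simp [qEntry, PrimeEntry.codes, w₁, w₂]

/-- `W₁` is a prime above `q` of norm `q`. [cite: Cohen1993, §4.8.2] -/
theorem w₁_of_check (hθ : aeval θ (MonicCubic.poly fc.a fc.b fc.c) = 0) (h3 : finrank ℚ K = 3)
    (hF : fc.check = true) (hpr : fc.primeList.Forall Nat.Prime) :
    idealOf hθ fc.w₁ ∈ primesOver (span {(fc.q : ℤ)}) (𝓞 K) ∧ absNorm (idealOf hθ fc.w₁) = fc.q := by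
  have h := (primeEntry_sound (fc.irreducible_of_check hF) hθ h3 fc.qEntry (fc.q_prime hpr)
    (fc.qEntry_check hF)).1 fc.w₁ (by rw [qEntry_codes]; simp)
  have hdeg : codeDeg fc.w₁ = 1 := by simp [codeDeg, w₁]
  rw [hdeg, pow_one] at h
  exact h

/-- `W₂` is a prime above `q` of norm `q²`. [cite: Cohen1993, §4.8.2] -/
theorem w₂_of_check (hθ : aeval θ (MonicCubic.poly fc.a fc.b fc.c) = 0) (h3 : finrank ℚ K = 3)
    (hF : fc.check = true) (hpr : fc.primeList.Forall Nat.Prime) :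
    idealOf hθ fc.w₂ ∈ primesOver (span {(fc.q : ℤ)}) (𝓞 K) ∧ absNorm (idealOf hθ fc.w₂) = fc.q ^ 2 := by
  have h := (primeEntry_sound (fc.irreducible_of_check hF) hθ h3 fc.qEntry (fc.q_prime hpr)
    (fc.qEntry_check hF)).1 fc.w₂ (by rw [qEntry_codes]; simp)
  have hdeg : codeDeg fc.w₂ = 2 := by simp [codeDeg, w₂]
  rw [hdeg] at h
  exact h

/-- Every prime containing `q` is `W₁` or `W₂`. [cite: Cohen1993, §4.8.2, Thm. 4.8.13] -/
theorem qcover_of_check (hθ : aeval θ (MonicCubic.poly fc.a fc.b fc.c) = 0) (h3 : finrank ℚ K = 3)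
    (hF : fc.check = true) (hpr : fc.primeList.Forall Nat.Prime) (P : Ideal (𝓞 K)) (hP : P.IsPrime)
    (hq : (fc.q : 𝓞 K) ∈ P) : P = idealOf hθ fc.w₁ ∨ P = idealOf hθ fc.w₂ := by
  obtain ⟨C, hC, rfl⟩ := (primeEntry_sound (fc.irreducible_of_check hF) hθ h3 fc.qEntry (fc.q_prime hpr)
    (fc.qEntry_check hF)).2 P hP hq
  rw [qEntry_codes] at hC
  simp only [List.mem_cons, List.not_mem_nil, or_false] at hC
  rcases hC with rfl | rfl
  · exact Or.inl rfl
  · exact Or.inr rfl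

/-- `W₁ ≠ W₂` (different norms). [folklore] -/
theorem w₁_ne_w₂ (hθ : aeval θ (MonicCubic.poly fc.a fc.b fc.c) = 0) (h3 : finrank ℚ K = 3)
    (hF : fc.check = true) (hpr : fc.primeList.Forall Nat.Prime) :
    idealOf hθ fc.w₁ ≠ idealOf hθ fc.w₂ := by
  intro h
  have h₁ := (fc.w₁_of_check hθ h3 hF hpr).2
  have h₂ := (fc.w₂_of_check hθ h3 hF hpr).2
  rw [h, h₂] at h₁
  have hq := (fc.q_prime hpr).one_lt
  have : fc.q ^ 2 = fc.q ^ 1 := by rw [pow_one]; exact h₁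
  exact absurd (Nat.pow_right_injective hq this) (by norm_num)

/-! ### The Minkowski sweep -/

/-- A prime has no small factor flag. [folklore] -/
theorem smallFactor_eq_false {n : ℕ} (hn : n.Prime) : smallFactor n = false := by
  rw [Bool.eq_false_iff]
  intro h
  simp only [smallFactor, List.any_eq_true, List.mem_range, Bool.and_eq_true, decide_eq_true_eq,
    beq_iff_eq] at h
  obtain ⟨d, -, ⟨⟨h2, hdd⟩, hmod⟩⟩ := h
  have hdvd : d ∣ n := Nat.dvd_of_mod_eq_zero hmod
  rcases (Nat.dvd_prime hn).mp hdvd with h1 | hdn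
  · omega
  · rw [hdn] at hdd
    nlinarith [hn.two_le]

/-- `codeDeg` is positive. -/
theorem codeDeg_pos (C : PCode) : 0 < codeDeg C := by
  unfold codeDeg; split_ifs <;> norm_num

/-- **The classes of the primes above `q` generate the class group.**
[cite: Marcus2018, Ch. 5, Cor. 2 to Thm. 35] [cite: Cohen1993, §6.5] -/
theorem closure_q_eq_top_of_check (hθ : aeval θ (MonicCubic.poly fc.a fc.b fc.c) = 0)
    (h3 : finrank ℚ K = 3) (hF : fc.check = true) (hpr : fc.primeList.Forall Nat.Prime) :
    Subgroup.closure {cc : ClassGroup (𝓞 K) | ∃ (J : Ideal (𝓞 K)) (hJ : J ∈ (Ideal (𝓞 K))⁰),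
      ((fc.q : ℕ) : 𝓞 K) ∈ J ∧ ClassGroup.mk0 ⟨J, hJ⟩ = cc} = ⊤ := by
  have hirr := fc.irreducible_of_check hF
  have hF' := hF
  simp only [check, checkSweep, Bool.and_eq_true, decide_eq_true_eq, List.all_eq_true, List.mem_range,
    Bool.or_eq_true, beq_iff_eq, List.any_eq_true] at hF'
  obtain ⟨⟨⟨-, ⟨⟨hd, hcov⟩, hcls⟩⟩, -⟩, -⟩ := hF'
  refine eq_top_of_classIn_lt hirr hθ h3 (b := fc.bM) hd fun p hpb hp P hP hlt => ?_
  have hpP : (p : 𝓞 K) ∈ P := sweep_natCast_mem p hP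
  have hPr : P.IsPrime := hP.1
  rcases hcov p hpb with ((hlt2 | hsf) | rfl) | ⟨e, he, hep⟩
  · exact absurd hp.two_le (by omega)
  · rw [smallFactor_eq_false hp] at hsf; exact absurd hsf Bool.false_ne_true
  · rcases fc.qcover_of_check hθ h3 hF hpr P hPr hpP with h | h <;> rw [h]
    · exact classIn_tsupp_span_pair_self _ _
    · exact classIn_tsupp_span_pair_self _ _
  · subst hep
    have hrow := (fc.row_check_of_mem hF he).1
    have hp' := fc.prime_of_mem hpr he
    obtain ⟨C, hC, rfl⟩ := cover_of_check hirr hθ h3 hp' hrow P hPr hpP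
    rcases hcls e he with hb | hall
    · exfalso
      refine not_pow_inertiaDeg_lt (mem_primesOver_of_check hirr hθ h3 hp' hrow hC)
        (absNorm_of_check hirr hθ h3 hp' hrow hC) ?_ hlt
      exact hb.trans (Nat.le_self_pow (codeDeg_pos C).ne' _)
    · obtain ⟨d, -, hcc⟩ := hall C hC
      exact classIn_of_classCheck hirr hθ h3 hp' hrow hC (fc.q_prime hpr) hcc hlt

/-! ### Residue characters -/

/-- **The residue map `ψ_{ℓ,t} : 𝓞 K → ℤ/ℓ`, `α ↦ t`**, for every character row, with `ℓ` an odd prime.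
[cite: Marcus2018, Ch. 3, Thm. 27] -/
theorem exists_psi_of_check (hθ : aeval θ (MonicCubic.poly fc.a fc.b fc.c) = 0) (h3 : finrank ℚ K = 3)
    (hF : fc.check = true) (hpr : fc.primeList.Forall Nat.Prime) {ch : ℕ × ℤ × ℤ} (hch : ch ∈ fc.chars) :
    2 < ch.1 ∧ ∃ ψ : 𝓞 K →+* ZMod ch.1, ψ (MonicCubic.thetaInt hθ) = ((ch.2.1 : ℤ) : ZMod ch.1) := by
  have hirr := fc.irreducible_of_check hF
  simp only [check, checkChars, Bool.and_eq_true, decide_eq_true_eq, List.all_eq_true] at hF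
  obtain ⟨⟨h2, hroot⟩, hinv⟩ := hF.2 ch hch
  obtain ⟨ℓ, t, dinv⟩ := ch
  simp only at h2 hroot hinv ⊢
  have hℓ : ℓ.Prime := fc.char_prime hpr hch
  haveI : NeZero ℓ := ⟨hℓ.ne_zero⟩
  refine ⟨h2, MonicCubic.exists_ringHom_of_root_of_mul_mem hirr hθ h3 (natAbs_disc_mul_mem_adjoin hirr hθ h3)
    ((t : ℤ) : ZMod ℓ) ?_ ((dinv : ℤ) : ZMod ℓ) ?_⟩
  · have h0 := (ZMod.intCast_zmod_eq_zero_iff_dvd _ ℓ).mpr (Int.dvd_of_emod_eq_zero hroot)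
    push_cast at h0
    exact h0
  · have h1 : ((((MonicCubic.disc fc.a fc.b fc.c).natAbs : ℤ) * dinv : ℤ) : ZMod ℓ) = ((1 : ℤ) : ZMod ℓ) := by
      rw [ZMod.intCast_eq_intCast_iff', hinv, Int.emod_eq_of_lt (by norm_num) (by have := hℓ.one_lt; omega)]
    simp only [Int.cast_mul, Int.cast_natCast, Int.cast_one] at h1
    exact h1

end ClFieldCert

/-! ## Kernel sanity check: the census field `M283` (`g = X³ + 4X − 1`, `q = 19 = W₁W₂`, `h = 2`) -/

/-- The v1 pilot field as a record: registry rows `2, 3` (sweep, `bM = 5`), `283` (ramified, split codes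
`α − 248`, `α − 70`), characters `ψ_{3,2}`, `ψ_{5,2}`, `ψ_{31,24}`. [folklore] -/
def m283 : ClFieldCert :=
  ⟨0, 4, -1, 7, 123/500, 247/1000, 5, 19, (3, 3, 13), (2, 0, 0), [(3, 2, 1), (5, 2, 2), (31, 24, 8)],
    ⟨(0, 0, 0), (-4, 0, -1), true, (0, -1, 0), 0, 0, (0, 0, 0), []⟩,
    ⟨(0, 0, 0), (10, 0, 1), false, (36, 1, -6), 2, 2, (-9, 6, -3), []⟩,
    [⟨2, 1, (1, 1, 1), (0, 2, 0), [(3, -1, 0, 1), (7, 1, 1, 1)], []⟩,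
     ⟨3, 1, (2, 2, 2), (1, 2, 0), [(1, 0, 2, 1)], []⟩,
     ⟨283, 0, (248, 248, 70), (15213, -340, 2), [], []⟩]⟩

/-- The record passes the checker. -/
example : m283.check = true := by decide +kernel

end Summit.BirchSwinnertonDyer.BirchSwinnertonDyer.Rank2Observatory.TwoDescCl

end
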